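import Summits.QuantumFields.BalabanUV.Beta.GAN24.DirichletExhaustionDeltaZSymm
import Summits.QuantumFields.BalabanUV.Beta.GAN24.DirichletExhaustionElimZ
import Summits.QuantumFields.BalabanUV.Beta.GAN24.DirichletExhaustionCovariancePad
import Summits.QuantumFields.BalabanUV.Beta.GAN24.DirichletExhaustionWall

/-!
# `BalabanUV.Beta.GAN24.DirichletExhaustionAssembly` — binder row G-an2-4 / (CONV-C), part P2, PART 15 = skeleton node S5 MODULO ONE NAMED INPUT: the
# END ASSEMBLY for Bałaban's `C^{(k)}(𝟙) = C·(CᵀΔ_kC)⁻¹·Cᵀ` at `U = 1` on ℤ^{d+1} — (CONV-C), `θ = L⁻²`, constants explicit in `(d, L)` —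
# from the typed objects `elimZ L` (PART 11), `deltaZ L` (PARTS 8/9) and the padded socket (PART 10), CONDITIONAL on exactly one hypothesis
# shape: (2.157) on ℤ^{d+1} in padded form, `Coer2157Z` (= skeleton S3.c/S3.e/S4.b, OPEN) (unit b2b-balaban-gan24-p2, gen 1, v1)

HONEST FRAMING (cell contract, verbatim): «discharging `BetaPertH` makes Bałaban's UV stability UNCONDITIONAL — a real constructive-QFT
result; it is NOT the continuum limit and NOT the Clay problem.»  THIS FILE closes the skeleton's assembly node S5 UP TO ONE BINDER: of the five
inputs of `CovInputPad` for `(C, Δ, Free) := (elimZ L, deltaZ L, IsFreeZ L)`, FOUR are theorems of PARTS 8/9/11 (`elimZ_bound`, `deltaZ_inputs3`),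
and the fifth — the (2.157)-shape k-uniform coercivity of `pad(CᵀΔ_kC)` on every finite region — is carried as the [shape] `Coer2157Z d L γ`,
asserted of nothing (route: PART 12 periodisation + PART 13 tails + pv09-g6's torus (2.153) + PART 14's reduction + PART 11's `elimZ_iso`;
skeleton `HOME/b2b-balaban-gan24-p2/gen1/SKELETON-P2.md` S3.c/S3.e/S4.b).  Result: `convC_balaban_of_coer` (= T of the skeleton, conditional on
`Coer2157Z`) and `decayCauchy_balaban_of_coer` (T in the wall's currency).  NOT a discharge of (CONV-C) (the covariance constituent only, one
binder open, S6 dictionary to the wall's `KInvStep` excluded); NOT `BetaPertH`, NOT continuum, NOT Clay.  «not in print; our proof attempt».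

v1.1 STATUS NOTE (gen 10, DOCSTRING-ONLY; every declaration byte-identical to v1 p198869): the words «OPEN» / «one binder open» /
«asserted of nothing» above describe v1's state (gen 1, 2026-08-19).  The one binder `Coer2157Z` of this file was DISCHARGED in gen 2 by the
NEXT module of the road, PART 18 `GAN24/DirichletExhaustionCoer`: `coer2157Z : 1 ≤ d → Coer2157Z d L (gamma2153 (d+1) L)` (p199806; PART 14's
reduction `hcoer_of_lower` fed with PART 17's `lower2153_Z` = Bałaban's (2.153) on ℤ^{d+1} by torus exhaustion, pv09's `lowerOnConstrainedT_of_represents`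
BY NAME), which applies `convC_balaban_of_coer` / `decayCauchy_balaban_of_coer` below to give the road's UNCONDITIONAL T
`DirichletExhaustionCoer.convC_balaban` (`d ≥ 1`, `L ≥ 1`) and `decayCauchy_balaban` (`L ≥ 2`).  This file is kept conditional by design (it is the
assembly step; the discharge imports it); nothing else changed.  Still NOT the K-slot, NOT `BetaPertH`, NOT continuum, NOT Clay.

ABSOLUTE RULE (cell, verbatim): «No internally-minted statement may enter as a cited fact. Every hypothesis is either kernel-proved in this
package or a verbatim quotation of a PUBLISHED theorem with page reference. The manuscript(s) under audit are NOT citable for their own disputed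
steps — they are the thing under adjudication; programme-internal (2001/route/tribunal) claims are never citable.»

WHAT IS PROVED (0 sorry): [shape] `Coer2157Z`; `covInputPad_balaban` (the padded socket's five inputs for Bałaban's objects from `Coer2157Z`);
**`convC_balaban_of_coer`**; `decayCauchy_balaban_of_coer` (`L ≥ 2`).  Constants: `c_C = e^{κZ(L−1)}`, `c₀ = c166Z d`, `δ = κZ d`, `θ₀ = θ166Z d`,
`θ = L⁻²`, through PART 10's displayed `convC_covPad` constants.  NOT summit progress.
-/

namespace Summit.QuantumFields.BalabanUV.Beta.GAN24.DirichletExhaustionAssembly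

open Finset Real
open Literature.MathematicalPhysics.QuantumFieldTheory.Balaban1983to89
open B4Sect5Proof (cStar deltaStar cStar_pos deltaStar_pos)
open B4Sect5Exhaustion (K toMat)
open Summit.QuantumFields.BalabanUV.Beta.GAN24.DirichletExhaustion
open Summit.QuantumFields.BalabanUV.Beta.GAN24.DirichletExhaustionFamily
open Summit.QuantumFields.BalabanUV.Beta.GAN24.DirichletExhaustionSandwich
open Summit.QuantumFields.BalabanUV.Beta.GAN24.DirichletExhaustionCovariance
open Summit.QuantumFields.BalabanUV.Beta.GAN24.DirichletExhaustionCovariancePad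
open Summit.QuantumFields.BalabanUV.Beta.GAN24.DirichletExhaustionDeltaZ
open Summit.QuantumFields.BalabanUV.Beta.GAN24.DirichletExhaustionDeltaZSymm (deltaZ_inputs3)
open Summit.QuantumFields.BalabanUV.Beta.GAN24.DirichletExhaustionElimZ (IsFreeZ elimZ elimZ_bound)
open Summit.QuantumFields.BalabanUV.Beta.GAN24.DirichletExhaustionDecays (toMKer)
open Summit.QuantumFields.BalabanUV.Beta.GAN24.DirichletExhaustionWall (decayCauchy_of_convC)
open Summit.QuantumFields.BalabanUV.Beta.GAN24.CombesThomas (DecayCauchy)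

noncomputable section

variable {d : ℕ}

/-! ## §1 The one remaining input, as a shape -/

/-- [shape] **(2.157) on ℤ^{d+1}, padded form** — the ONE remaining input of the skeleton (nodes S3.c/S3.e/S4.b): for every `k` and every finite
region `Λ`, `γ‖v‖² ≤ ⟨v, (pad(CᵀΔ_kC))_Λ v⟩` with `C = elimZ L`, `Δ_k = deltaZ L k`, free set `IsFreeZ L` ([Balaban1984PropagatorsII] (2.157) reads
`⟨B′, C*Δ_kCB′⟩ ≥ γ′₀‖B′‖²` on the remaining variables; `γ′₀ = (γ₀/12d²)L^{−d−1}`).  Asserted of nothing. -/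
def Coer2157Z (d L : ℕ) [NeZero L] (γ : ℝ) : Prop :=
  ∀ k (Λ : Finset (Fin (d + 1) → ℤ)) (v : B4.Idx Λ (d + 1) → ℝ),
    γ * ∑ p, v p ^ 2 ≤ ∑ p, v p * (toMat Λ (padOp (IsFreeZ L) (sandwich (elimZ L) (deltaZ L k)))).mulVec v p

/-! ## §2 The padded socket's inputs for Bałaban's objects -/

/-- **The five inputs of PART 10's `CovInputPad` for `(elimZ L, deltaZ L, IsFreeZ L)`**, four of them THEOREMS (PARTS 8/9/11), the fifth = `Coer2157Z`. -/
theorem covInputPad_balaban (L : ℕ) [NeZero L] {γ : ℝ} (h : Coer2157Z d L γ) :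
    CovInputPad (Set.univ : Set (Fin (d + 1) → ℤ)) (elimZ L) (deltaZ L) (IsFreeZ L)
      (Real.exp (kappaZ d * ((L : ℝ) - 1))) (c166Z d) (kappaZ d) γ (theta166Z d) (((L : ℝ) ^ 2)⁻¹) where
  hC r p := elimZ_bound (Nat.pos_of_ne_zero (NeZero.ne L)) (kappaZ_pos d).le r p
  hΔ := (deltaZ_inputs3 L).1
  hΔsymm := (deltaZ_inputs3 L).2.1
  hstep := (deltaZ_inputs3 L).2.2
  hcoer k Λ _ v := h k Λ v

/-! ## §3 T, conditional on `Coer2157Z` -/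

/-- `θ166Z ≥ 0`. -/
theorem theta166Z_nonneg (d : ℕ) : 0 ≤ theta166Z d := by
  unfold theta166Z; have := T4Rate166StripDirect.C166_pos (d + 1); positivity

/-- **T (skeleton §0) CONDITIONAL ON `Coer2157Z`**: for Bałaban's typed objects on ℤ^{d+1}, the padded (2.156)-shaped covariance family
`k ↦ C·(pad(CᵀΔ_kC))_Λ⁻¹·Cᵀ` satisfies (CONV-C) on EVERY `Λ ⊆ ℤ^{d+1}` with ratio `θ = L⁻²` and the displayed constants of PART 10 at
`(c_C, c₀, δ, γ, θ₀) = (e^{κZ(L−1)}, c166Z d, κZ d, γ, θ166Z d)`. -/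
theorem convC_balaban_of_coer (L : ℕ) [NeZero L] {γ : ℝ} (hγ : 0 < γ) (h : Coer2157Z d L γ) (Λ : Set (Fin (d + 1) → ℤ)) :
    ConvC (covPad (elimZ L) (deltaZ L) (IsFreeZ L) Λ)
      (sandwichConst (d + 1) (d + 1) (Real.exp (kappaZ d * ((L : ℝ) - 1)))
          (deltaStar (d + 1) (d + 1) γ
            (max (sandwichConst (d + 1) (d + 1) (Real.exp (kappaZ d * ((L : ℝ) - 1))) (kappaZ d) * c166Z d) 1) (kappaZ d / 2)) *
        convConst (d + 1) (d + 1) γ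
          (max (sandwichConst (d + 1) (d + 1) (Real.exp (kappaZ d * ((L : ℝ) - 1))) (kappaZ d) * c166Z d) 1) (kappaZ d / 2)
          (sandwichConst (d + 1) (d + 1) (Real.exp (kappaZ d * ((L : ℝ) - 1))) (kappaZ d) * theta166Z d))
      (deltaStar (d + 1) (d + 1) γ
          (max (sandwichConst (d + 1) (d + 1) (Real.exp (kappaZ d * ((L : ℝ) - 1))) (kappaZ d) * c166Z d) 1) (kappaZ d / 2) / 2)
      (((L : ℝ) ^ 2)⁻¹) :=
  convC_covPad (covInputPad_balaban L h) (kappaZ_pos d) (Real.exp_pos _).le hγ (theta166Z_nonneg d) (by positivity)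
    (Set.subset_univ Λ)

/-- **T in the wall's currency, conditional on `Coer2157Z`** (`L ≥ 2`, so `θ = L⁻² < 1`): `DecayCauchy (k ↦ toMKer (covPad … Λ k)) (C₄/(1−L⁻²)) L⁻² (δ₄/(d+1))`. -/
theorem decayCauchy_balaban_of_coer (L : ℕ) [NeZero L] (hL : 2 ≤ L) {γ : ℝ} (hγ : 0 < γ) (h : Coer2157Z d L γ)
    (Λ : Set (Fin (d + 1) → ℤ)) :
    ∃ C₄ δ₄ : ℝ, 0 ≤ C₄ ∧ 0 < δ₄ ∧
      ConvC (covPad (elimZ L) (deltaZ L) (IsFreeZ L) Λ) C₄ δ₄ (((L : ℝ) ^ 2)⁻¹) ∧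
      DecayCauchy (fun k => toMKer (covPad (elimZ L) (deltaZ L) (IsFreeZ L) Λ k)) (C₄ / (1 - ((L : ℝ) ^ 2)⁻¹)) (((L : ℝ) ^ 2)⁻¹)
        (δ₄ / ((d + 1 : ℕ) : ℝ)) := by
  have hconv := convC_balaban_of_coer L hγ h Λ
  have hc' : 0 < max (sandwichConst (d + 1) (d + 1) (Real.exp (kappaZ d * ((L : ℝ) - 1))) (kappaZ d) * c166Z d) 1 :=
    lt_max_of_lt_right one_pos
  have hδs : 0 < deltaStar (d + 1) (d + 1) γ
      (max (sandwichConst (d + 1) (d + 1) (Real.exp (kappaZ d * ((L : ℝ) - 1))) (kappaZ d) * c166Z d) 1) (kappaZ d / 2) :=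
    deltaStar_pos (d + 1) (d + 1) hγ hc'.le (half_pos (kappaZ_pos d))
  have hC₄ : 0 ≤ sandwichConst (d + 1) (d + 1) (Real.exp (kappaZ d * ((L : ℝ) - 1)))
          (deltaStar (d + 1) (d + 1) γ
            (max (sandwichConst (d + 1) (d + 1) (Real.exp (kappaZ d * ((L : ℝ) - 1))) (kappaZ d) * c166Z d) 1) (kappaZ d / 2)) *
        convConst (d + 1) (d + 1) γ
          (max (sandwichConst (d + 1) (d + 1) (Real.exp (kappaZ d * ((L : ℝ) - 1))) (kappaZ d) * c166Z d) 1) (kappaZ d / 2)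
          (sandwichConst (d + 1) (d + 1) (Real.exp (kappaZ d * ((L : ℝ) - 1))) (kappaZ d) * theta166Z d) := by
    have h1 := sandwichConst_nonneg (d + 1) (d + 1) (Real.exp (kappaZ d * ((L : ℝ) - 1))) hδs
    have h2 : 0 ≤ convConst (d + 1) (d + 1) γ
        (max (sandwichConst (d + 1) (d + 1) (Real.exp (kappaZ d * ((L : ℝ) - 1))) (kappaZ d) * c166Z d) 1) (kappaZ d / 2)
        (sandwichConst (d + 1) (d + 1) (Real.exp (kappaZ d * ((L : ℝ) - 1))) (kappaZ d) * theta166Z d) :=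
      (cStar_pos (d + 1) (d + 1) _ _ hγ).le.trans (le_max_left _ _)
    exact mul_nonneg h1 h2
  have hθ0 : (0 : ℝ) ≤ ((L : ℝ) ^ 2)⁻¹ := by positivity
  have hθ1 : ((L : ℝ) ^ 2)⁻¹ < 1 := by
    have hL' : (2 : ℝ) ≤ L := by exact_mod_cast hL
    have : (1 : ℝ) < (L : ℝ) ^ 2 := by nlinarith
    exact inv_lt_one_of_one_lt₀ this
  refine ⟨_, _, hC₄, half_pos hδs, hconv, ?_⟩
  exact decayCauchy_of_convC hC₄ (half_pos hδs).le hθ0 hθ1 hconv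

end

end Summit.QuantumFields.BalabanUV.Beta.GAN24.DirichletExhaustionAssembly
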